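import Mathlib
import HarnessLib

/-!
# A kernel-checkable Gram certificate for lower bounds of integer quadratic forms

Topic `LinearAlgebra/Matrix`. Everything here is PROVED; the file is the VERIFICATION side of the
rounded-Gram-factor certificates whose EXISTENCE in polynomial size is `IntegerGramCertificate`
(same directory): to certify a lower bound `uᴴ M u ≥ -(ρ/c) ‖u‖²` for a symmetric integer matrix `M`
one exhibits an integer matrix `G` (a rounded Cholesky factor of `c M`) such that the integer
remainder `F = c M - G Gᵀ` has all row and column absolute sums `≤ ρ`; then
`c · uᴴ M u = ‖Gᵀ u‖² + uᴴ F u ≥ -ρ ‖u‖²` (Gershgorin / diagonal dominance).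

The check is a closed Boolean computation on literal data (`Literature.LinearAlgebra.Matrix.gramCheck`,
lists of lists of integers, evaluated by the kernel with `decide +kernel`), and the soundness
theorem `re_quadForm_ge_of_gramCheck` turns `gramCheck n M G c ρ = true` into the real inequality
for every complex vector `u : Fin n → ℂ`. Large literal matrices are best supplied base-`B` packed
in one natural number (`decodeMat`), which the kernel unpacks with GMP arithmetic; this avoids the
elaboration cost of long list literals. Used by finite-cluster exact-diagonalisation certificates
(e.g. the Hubbard plaquette data of `Summits/HubbardSuperconductivity`).

References: folklore (validated numerics: rounded Cholesky factor plus a Gershgorin bound on the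
residual, e.g. S. M. Rump, *Verification methods: rigorous results using floating-point arithmetic*,
Acta Numerica 19 (2010) §10.8); A. Schrijver, *Theory of Linear and Integer Programming* (1986) §3.3.
-/

namespace Literature.LinearAlgebra.Matrix

open Finset

/-! ### List matrices and the Boolean check -/

/-- Entry `(i, j)` of a list-of-rows integer matrix (`0` outside the stored range). [folklore] -/
def lmEntry (A : List (List ℤ)) (i j : ℕ) : ℤ := (A.getD i []).getD j 0

/-- Dot product of two integer lists (truncated to the shorter one). [folklore] -/
def dotZ : List ℤ → List ℤ → ℤ
  | a :: as, b :: bs => a * b + dotZ as bs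
  | _, _ => 0

/-- Entry `(i, j)` of the Gram matrix `G Gᵀ` of a list matrix (rows `i`, `j` of `G`). [folklore] -/
def gramEntry (G : List (List ℤ)) (i j : ℕ) : ℤ := dotZ (G.getD i []) (G.getD j [])

/-- The remainder `F = c M - G Gᵀ`, entrywise. [folklore] -/
def gramResidual (M G : List (List ℤ)) (c : ℕ) (i j : ℕ) : ℤ :=
  (c : ℤ) * lmEntry M i j - gramEntry G i j

/-- Row absolute sum `∑_{j < n} |F i j|`. [folklore] -/
def residualRowSum (M G : List (List ℤ)) (c n i : ℕ) : ℕ :=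
  ((List.range n).map fun j => (gramResidual M G c i j).natAbs).sum

/-- Column absolute sum `∑_{i < n} |F i j|`. [folklore] -/
def residualColSum (M G : List (List ℤ)) (c n j : ℕ) : ℕ :=
  ((List.range n).map fun i => (gramResidual M G c i j).natAbs).sum

/-- **The Gram certificate check**: every row and column absolute sum of `c M - G Gᵀ` over the
leading `n × n` block is `≤ ρ`. A closed Boolean, meant to be evaluated by the kernel.
[folklore] -/
def gramCheck (n : ℕ) (M G : List (List ℤ)) (c ρ : ℕ) : Bool :=
  (List.range n).all fun i => decide (residualRowSum M G c n i ≤ ρ) && decide (residualColSum M G c n i ≤ ρ)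

/-- Unpack `k` integers from the base-`B` digits of `N`, each shifted by `-off`
(returns the row and the remaining quotient). [folklore] -/
def decodeRow (B : ℕ) (off : ℤ) : ℕ → ℕ → List ℤ × ℕ
  | 0, N => ([], N)
  | k + 1, N =>
    let r := decodeRow B off k (N / B)
    ((((N % B : ℕ) : ℤ) - off) :: r.1, r.2)

/-- Unpack an `r × k` integer matrix from one natural number (row-major, base `B`, offset `off`):
the compact literal format for certificate data. [folklore] -/
def decodeMat (B : ℕ) (off : ℤ) : ℕ → ℕ → ℕ → List (List ℤ)
  | 0, _, _ => []
  | r + 1, k, N =>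
    let p := decodeRow B off k N
    p.1 :: decodeMat B off r k p.2

/-! ### Soundness -/

/-- A bound on all row lengths of a list matrix. [folklore] -/
def maxRowLen (G : List (List ℤ)) : ℕ := G.foldr (fun r acc => max r.length acc) 0

/-- Every stored row is at most `maxRowLen` long. [folklore] -/
theorem length_getD_le_maxRowLen (G : List (List ℤ)) (i : ℕ) : (G.getD i []).length ≤ maxRowLen G := by
  induction G generalizing i with
  | nil => simp [maxRowLen]
  | cons r G ih =>
    cases i with
    | zero => simp [maxRowLen]
    | succ i =>
      simp only [List.getD_cons_succ, maxRowLen, List.foldr_cons]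
      exact (ih i).trans (le_max_right _ _)

/-- `dotZ` is the sum of products of entries over any range containing both lists. [folklore] -/
theorem dotZ_eq_sum (r s : List ℤ) (m : ℕ) (hr : r.length ≤ m) (hs : s.length ≤ m) :
    dotZ r s = ∑ k ∈ range m, r.getD k 0 * s.getD k 0 := by
  induction r generalizing s m with
  | nil => simp [dotZ]
  | cons a r ih =>
    cases s with
    | nil => simp [dotZ]
    | cons b s =>
      cases m with
      | zero => simp at hr
      | succ m =>
        simp only [List.length_cons, Nat.succ_le_succ_iff] at hr hs
        rw [dotZ, Finset.sum_range_succ', ih s m hr hs]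
        simp [add_comm]

/-- The Gram entry as a finite sum: `(G Gᵀ) i j = ∑_{k < maxRowLen G} G i k · G j k`. [folklore] -/
theorem gramEntry_eq_sum (G : List (List ℤ)) (i j : ℕ) :
    gramEntry G i j = ∑ k ∈ range (maxRowLen G), lmEntry G i k * lmEntry G j k :=
  dotZ_eq_sum _ _ _ (length_getD_le_maxRowLen G i) (length_getD_le_maxRowLen G j)

/-- A list sum over `List.range n` is a `Finset.range` sum. [folklore] -/
theorem sum_map_range_eq (f : ℕ → ℕ) (n : ℕ) : ((List.range n).map f).sum = ∑ j ∈ range n, f j := by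
  induction n with
  | zero => simp
  | succ n ih => rw [List.range_succ, List.map_append, List.sum_append, ih, Finset.sum_range_succ]; simp

/-- What a passing check says about the row sums. [folklore] -/
theorem rowSum_le_of_gramCheck {n : ℕ} {M G : List (List ℤ)} {c ρ : ℕ} (h : gramCheck n M G c ρ = true)
    (i : Fin n) : ∑ j : Fin n, ((gramResidual M G c i j).natAbs : ℝ) ≤ ρ := by
  have h1 : residualRowSum M G c n i ≤ ρ := by
    have := List.all_eq_true.1 h i (List.mem_range.2 i.isLt)
    simp only [Bool.and_eq_true, decide_eq_true_eq] at this
    exact this.1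
  rw [residualRowSum, sum_map_range_eq, ← Fin.sum_univ_eq_sum_range] at h1
  exact_mod_cast h1

/-- What a passing check says about the column sums. [folklore] -/
theorem colSum_le_of_gramCheck {n : ℕ} {M G : List (List ℤ)} {c ρ : ℕ} (h : gramCheck n M G c ρ = true)
    (j : Fin n) : ∑ i : Fin n, ((gramResidual M G c i j).natAbs : ℝ) ≤ ρ := by
  have h1 : residualColSum M G c n j ≤ ρ := by
    have := List.all_eq_true.1 h j (List.mem_range.2 j.isLt)
    simp only [Bool.and_eq_true, decide_eq_true_eq] at this
    exact this.2
  rw [residualColSum, sum_map_range_eq] at h1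
  rw [Fin.sum_univ_eq_sum_range (fun i => ((gramResidual M G c i j).natAbs : ℝ))]
  exact_mod_cast h1

/-- The Gram part of the form is a sum of squares: `Re uᴴ (G Gᵀ) u = ∑_k |∑_i G i k u i|² ≥ 0`.
[folklore] -/
theorem re_gramForm_nonneg {n : ℕ} (G : List (List ℤ)) (u : Fin n → ℂ) :
    0 ≤ (∑ i : Fin n, ∑ j : Fin n, star (u i) * (gramEntry G i j : ℂ) * u j).re := by
  set m := maxRowLen G
  set z : ℕ → ℂ := fun k => ∑ j : Fin n, (lmEntry G j k : ℂ) * u j with hz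
  have hterm : ∀ i j : Fin n, star (u i) * (gramEntry G i j : ℂ) * u j =
      ∑ k ∈ range m, (star (u i) * (lmEntry G i k : ℂ)) * ((lmEntry G j k : ℂ) * u j) := by
    intro i j
    rw [gramEntry_eq_sum, Int.cast_sum, Finset.mul_sum, Finset.sum_mul]
    refine Finset.sum_congr rfl fun k _ => ?_
    push_cast
    ring
  have hexp : ∑ i : Fin n, ∑ j : Fin n, star (u i) * (gramEntry G i j : ℂ) * u j =
      ∑ k ∈ range m, star (z k) * z k := by
    calc ∑ i : Fin n, ∑ j : Fin n, star (u i) * (gramEntry G i j : ℂ) * u j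
        = ∑ i : Fin n, ∑ j : Fin n, ∑ k ∈ range m,
            (star (u i) * (lmEntry G i k : ℂ)) * ((lmEntry G j k : ℂ) * u j) := by
          simp only [hterm]
      _ = ∑ i : Fin n, ∑ k ∈ range m, ∑ j : Fin n,
            (star (u i) * (lmEntry G i k : ℂ)) * ((lmEntry G j k : ℂ) * u j) :=
          Finset.sum_congr rfl fun i _ => Finset.sum_comm
      _ = ∑ k ∈ range m, ∑ i : Fin n, ∑ j : Fin n,
            (star (u i) * (lmEntry G i k : ℂ)) * ((lmEntry G j k : ℂ) * u j) := Finset.sum_comm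
      _ = ∑ k ∈ range m, star (z k) * z k := by
          refine Finset.sum_congr rfl fun k _ => ?_
          rw [hz, star_sum, Finset.sum_mul_sum]
          refine Finset.sum_congr rfl fun i _ => Finset.sum_congr rfl fun j _ => ?_
          rw [star_mul', Complex.star_def, map_intCast]
          ring
  rw [hexp, Complex.re_sum]
  refine Finset.sum_nonneg fun k _ => ?_
  rw [Complex.star_def, ← Complex.normSq_eq_conj_mul_self]
  exact_mod_cast Complex.normSq_nonneg _

/-- Gershgorin-type bound: `Re uᴴ F u ≥ -½ ∑_{i,j} |F i j| (|u i|² + |u j|²) ≥ -ρ ‖u‖²` when all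
row and column absolute sums of `F` are `≤ ρ`. [folklore] -/
theorem re_residualForm_ge {n : ℕ} {M G : List (List ℤ)} {c ρ : ℕ} (h : gramCheck n M G c ρ = true)
    (u : Fin n → ℂ) :
    -(ρ : ℝ) * ∑ i : Fin n, ‖u i‖ ^ 2 ≤
      (∑ i : Fin n, ∑ j : Fin n, star (u i) * (gramResidual M G c i j : ℂ) * u j).re := by
  set F : Fin n → Fin n → ℝ := fun i j => ((gramResidual M G c i j).natAbs : ℝ) with hF
  have hF0 : ∀ i j, 0 ≤ F i j := fun i j => Nat.cast_nonneg _
  have hterm : ∀ i j : Fin n, -(F i j * ‖u i‖ ^ 2 / 2 + F i j * ‖u j‖ ^ 2 / 2) ≤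
      (star (u i) * (gramResidual M G c i j : ℂ) * u j).re := by
    intro i j
    have h1 : |(star (u i) * (gramResidual M G c i j : ℂ) * u j).re| ≤ F i j * (‖u i‖ * ‖u j‖) := by
      refine (Complex.abs_re_le_norm _).trans ?_
      rw [norm_mul, norm_mul, norm_star, Complex.norm_intCast, hF]
      simp only [Nat.cast_natAbs, Int.cast_abs]
      nlinarith [norm_nonneg (u i), norm_nonneg (u j), abs_nonneg ((gramResidual M G c i j : ℝ))]
    have h2 : ‖u i‖ * ‖u j‖ ≤ (‖u i‖ ^ 2 + ‖u j‖ ^ 2) / 2 := by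
      nlinarith [sq_nonneg (‖u i‖ - ‖u j‖)]
    nlinarith [abs_le.1 h1, mul_le_mul_of_nonneg_left h2 (hF0 i j)]
  have hre : -(∑ i : Fin n, ∑ j : Fin n, (F i j * ‖u i‖ ^ 2 / 2 + F i j * ‖u j‖ ^ 2 / 2)) ≤
      (∑ i : Fin n, ∑ j : Fin n, star (u i) * (gramResidual M G c i j : ℂ) * u j).re := by
    rw [Complex.re_sum, ← Finset.sum_neg_distrib]
    refine Finset.sum_le_sum fun i _ => ?_
    rw [Complex.re_sum, ← Finset.sum_neg_distrib]
    exact Finset.sum_le_sum fun j _ => hterm i j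
  have hA : ∑ i : Fin n, ∑ j : Fin n, F i j * ‖u i‖ ^ 2 / 2 ≤ (ρ : ℝ) * (∑ i : Fin n, ‖u i‖ ^ 2) / 2 := by
    rw [Finset.mul_sum, Finset.sum_div]
    refine Finset.sum_le_sum fun i _ => ?_
    rw [← Finset.sum_div, ← Finset.sum_mul]
    exact div_le_div_of_nonneg_right (mul_le_mul_of_nonneg_right (rowSum_le_of_gramCheck h i)
      (sq_nonneg _)) zero_le_two
  have hB : ∑ i : Fin n, ∑ j : Fin n, F i j * ‖u j‖ ^ 2 / 2 ≤ (ρ : ℝ) * (∑ j : Fin n, ‖u j‖ ^ 2) / 2 := by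
    rw [Finset.sum_comm, Finset.mul_sum, Finset.sum_div]
    refine Finset.sum_le_sum fun j _ => ?_
    rw [← Finset.sum_div, ← Finset.sum_mul]
    exact div_le_div_of_nonneg_right (mul_le_mul_of_nonneg_right (colSum_le_of_gramCheck h j)
      (sq_nonneg _)) zero_le_two
  have hsplit : ∑ i : Fin n, ∑ j : Fin n, (F i j * ‖u i‖ ^ 2 / 2 + F i j * ‖u j‖ ^ 2 / 2) =
      ∑ i : Fin n, ∑ j : Fin n, F i j * ‖u i‖ ^ 2 / 2 + ∑ i : Fin n, ∑ j : Fin n, F i j * ‖u j‖ ^ 2 / 2 := by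
    rw [← Finset.sum_add_distrib]
    exact Finset.sum_congr rfl fun i _ => Finset.sum_add_distrib
  rw [hsplit] at hre
  linarith

/-- **Soundness of the Gram certificate.** If `gramCheck n M G c ρ` passes with `c > 0`, then the
Hermitian form of the integer matrix `M` on `ℂⁿ` is bounded below:
`Re uᴴ M u ≥ -(ρ/c) ‖u‖²` for every `u : Fin n → ℂ` (write `c M = G Gᵀ + F`; the Gram part is a
sum of squares and the remainder is controlled by its row/column sums). [folklore] -/
theorem re_quadForm_ge_of_gramCheck {n : ℕ} {M G : List (List ℤ)} {c ρ : ℕ}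
    (h : gramCheck n M G c ρ = true) (hc : 0 < c) (u : Fin n → ℂ) :
    -((ρ : ℝ) / c) * ∑ i : Fin n, ‖u i‖ ^ 2 ≤
      (∑ i : Fin n, ∑ j : Fin n, star (u i) * (lmEntry M i j : ℂ) * u j).re := by
  have key : (c : ℂ) * ∑ i : Fin n, ∑ j : Fin n, star (u i) * (lmEntry M i j : ℂ) * u j =
      (∑ i : Fin n, ∑ j : Fin n, star (u i) * (gramEntry G i j : ℂ) * u j) +
        ∑ i : Fin n, ∑ j : Fin n, star (u i) * (gramResidual M G c i j : ℂ) * u j := by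
    rw [← Finset.sum_add_distrib, Finset.mul_sum]
    refine Finset.sum_congr rfl fun i _ => ?_
    rw [← Finset.sum_add_distrib, Finset.mul_sum]
    refine Finset.sum_congr rfl fun j _ => ?_
    simp only [gramResidual, Int.cast_sub, Int.cast_mul, Int.cast_natCast]
    ring
  have h1 := re_gramForm_nonneg G u
  have h2 := re_residualForm_ge h u
  set Q := ∑ i : Fin n, ∑ j : Fin n, star (u i) * (lmEntry M i j : ℂ) * u j with hQ
  have hre : (c : ℝ) * Q.re =
      (∑ i : Fin n, ∑ j : Fin n, star (u i) * (gramEntry G i j : ℂ) * u j).re +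
        (∑ i : Fin n, ∑ j : Fin n, star (u i) * (gramResidual M G c i j : ℂ) * u j).re := by
    rw [← Complex.add_re, ← key, ← Complex.ofReal_natCast, Complex.re_ofReal_mul]
  have hc' : (0 : ℝ) < c := by exact_mod_cast hc
  calc -((ρ : ℝ) / c) * ∑ i : Fin n, ‖u i‖ ^ 2 = (-(ρ : ℝ) * ∑ i : Fin n, ‖u i‖ ^ 2) / c := by ring
    _ ≤ ((c : ℝ) * Q.re) / c := div_le_div_of_nonneg_right (by linarith) hc'.le
    _ = Q.re := by field_simp

end Literature.LinearAlgebra.Matrix
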